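import Literature.Computability.Cryptography.CubicClassTableFPPow
import HarnessLib

/-!
# The class-group table on codes, IV: the reduced representative `b_e`, the target, the ladder base and the ladder

Theorem-only sequel of `CubicClassTableFPPow.lean` (parts I–III: the kernel, the layout arithmetic and the generators, the
clamped square-and-multiply with its size invariants). In pointwise `CodeFP` form (the instance `I s`, the cap `cap s` and
the position `v s` read off a context `s`):

* `exists_genLogBound` — one polynomial bounding the logs of the reduction program at every generator slot `gT v t`
  (a listed prime code or `ord`, bounded by the output-length polynomial of `gens`);
* `codeFP_bEc` — the clamped reduced representative `b_e` (the fold over the `T` slots, `CodeFP.foldlInv` with the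
  invariants of part II), `codeFP_Δc`, `codeFP_tstarc` — the clamped shift and the absolute target `t⋆`;
* `codeFP_KInt`, `codeFP_stepc`, `iterate_stepc_inv`, `codeFP_hbase` — the ladder base (`s₀` unguarded clamped baby
  steps, positions `≤ s₀ 2^K`), `ladder_inv`, `codeFP_ladder` — the ladder `g_i` (`i` clamped squarings,
  `|pos g_i| + 2^K ≤ 2^i (s₀ + 1) 2^K`), by `CodeFP.iterateInv`.

## References

* S. Arora, B. Barak, *Computational Complexity: A Modern Approach*, CUP 2009, §1.3. [AroraBarak2009]
* S. Hallgren, STOC 2005, §4. [Hallgren2005]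
* J. Buchmann, H. C. Williams, Math. Comp. 50 (1988), §3. [BuchmannWilliams1988]
-/

namespace Literature.Computability.Cryptography

namespace CubicClassTable

open Literature.Computability.Complexity Literature.Computability.Complexity.CodeFP Polynomial

namespace WalkFns

variable (F : WalkFns)

/-! ### The generators' logs -/

/-- **One polynomial bounds the logs of the reduction program at every generator slot**: `gT v t` is a listed prime
code or `ord`, whose codes are bounded by the output-length polynomial of `gens`. [cite: AroraBarak2009, §1.3] -/
theorem exists_genLogBound {σ : Type} {eσ : σ → List Bool} {I : σ → Inst} {v : σ → ℕ}
    (hroots : CodeFP (pairE natE (pairE natE strE)) (rawE natE) F.roots) (hprime : CodeFP (pairE (pairE natE natE) (pairE (pairE natE (rawE intE)) (pairE natE natE))) (pairE natE (rawE intE)) F.primeL)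
    (hred : CodeFP (pairE (pairE (pairE natE natE) unE) (pairE natE (rawE intE))) (pairE (pairE natE (rawE intE)) intE) F.redL)
    (hd : CodeFP eσ (pairE (pairE natE natE) unE) (fun s => (I s).d)) (hord : CodeFP eσ (pairE natE (rawE intE)) (fun s => (I s).ord))
    (hm : CodeFP eσ natE (fun s => (I s).m)) (hps : CodeFP eσ (rawE natE) (fun s => (I s).ps))
    (hℓe : CodeFP eσ unE (fun s => (I s).ℓe)) (hℓy : CodeFP eσ unE (fun s => (I s).ℓy))
    (hℓκ : CodeFP eσ unE (fun s => (I s).ℓκ)) (hℓb : CodeFP eσ unE (fun s => (I s).ℓb)) (hv : CodeFP eσ natE v) :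
    ∃ K' : Polynomial ℕ, ∀ s t, ((F.redL ((I s).d, F.gT (I s) (v s) t)).2).natAbs < 2 ^ K'.eval (eσ s).length := by
  obtain ⟨P, hP⟩ := exists_length_le_eval hred
  obtain ⟨Pd, hPd⟩ := exists_length_le_eval hd
  obtain ⟨Po, hPo⟩ := exists_length_le_eval hord
  obtain ⟨Pg, hPg⟩ := exists_length_le_eval (F.codeFP_gens hroots hprime hd hord hm hps hℓe hℓy hℓκ hℓb hv)
  refine ⟨P.comp (2 * Pd + Pg + Po + 2), fun s t => ?_⟩
  have hS : (pairE natE (rawE intE) (F.gT (I s) (v s) t)).length ≤ Pg.eval (eσ s).length + Po.eval (eσ s).length := by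
    unfold gT
    by_cases h : t < (F.gens (I s) (v s)).length
    · rw [List.getD_eq_getElem _ _ h]
      have := length_item_le_length_rawE (pairE natE (rawE intE)) (List.getElem_mem h)
      have := hPg s
      omega
    · rw [List.getD_eq_default _ _ (not_lt.1 h)]
      have := hPo s
      omega
  have h := (F.size_redL_le (I s).d (F.gT (I s) (v s) t) P hP (hPd s) hS).2
  refine lt_of_lt_of_le h (Nat.pow_le_pow_right Nat.two_pos ?_)
  rw [eval_comp]
  exact TM2Iter.eval_mono P (by simp only [eval_add, eval_mul, eval_ofNat]; omega)

/-! ### `b_e`, the shift and the target on codes -/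

/-- **The clamped reduced representative `b_e` is computed on codes** (pointwise form): a fold over the `T` generator
slots of the clamped square-and-multiply of the reduced generator codes to the exponent digits, whose accumulator stays
short by `bEcStep_label` / `bEcStep_pos`. [cite: AroraBarak2009, §1.3; Hallgren2005, §4] -/
theorem codeFP_bEc {σ : Type} {eσ : σ → List Bool} {I : σ → Inst} {cap v : σ → ℕ}
    (hroots : CodeFP (pairE natE (pairE natE strE)) (rawE natE) F.roots) (hprime : CodeFP (pairE (pairE natE natE) (pairE (pairE natE (rawE intE)) (pairE natE natE))) (pairE natE (rawE intE)) F.primeL)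
    (hlat : CodeFP (pairE (pairE natE natE) (pairE (pairE natE (rawE intE)) (pairE natE (rawE intE)))) (pairE natE (rawE intE)) F.latProd) (hred : CodeFP (pairE (pairE (pairE natE natE) unE) (pairE natE (rawE intE))) (pairE (pairE natE (rawE intE)) intE) F.redL)
    (hlat6 : ∀ x, (F.latProd x).2.length ≤ 6) (hred6 : ∀ x, ((F.redL x).1).2.length ≤ 6)
    (hd : CodeFP eσ (pairE (pairE natE natE) unE) (fun s => (I s).d)) (hord : CodeFP eσ (pairE natE (rawE intE)) (fun s => (I s).ord))
    (hcap : CodeFP eσ natE cap) (hm : CodeFP eσ natE (fun s => (I s).m)) (hps : CodeFP eσ (rawE natE) (fun s => (I s).ps))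
    (hℓe : CodeFP eσ unE (fun s => (I s).ℓe)) (hℓy : CodeFP eσ unE (fun s => (I s).ℓy))
    (hℓκ : CodeFP eσ unE (fun s => (I s).ℓκ)) (hℓb : CodeFP eσ unE (fun s => (I s).ℓb)) (hv : CodeFP eσ natE v) :
    CodeFP eσ (pairE (pairE natE (rawE intE)) intE) (fun s => F.bEc (I s) (cap s) (v s)) := by
  obtain ⟨K, hK⟩ := F.exists_logBound hred hd hord hcap
  obtain ⟨K', hK'⟩ := F.exists_genLogBound hroots hprime hred hd hord hm hps hℓe hℓy hℓκ hℓb hv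
  obtain ⟨Pl, hPl⟩ := exists_length_le_eval hℓe
  -- context `w = (s, (t, acc))`
  have e1 : CodeFP (pairE eσ (pairE natE (optE (pairE (pairE natE (rawE intE)) intE)))) eσ (fun w => w.1) := fst _ _
  have ht : CodeFP (pairE eσ (pairE natE (optE (pairE (pairE natE (rawE intE)) intE)))) natE (fun w => w.2.1) := (snd _ _).fst'
  have hacc : CodeFP (pairE eσ (pairE natE (optE (pairE (pairE natE (rawE intE)) intE)))) (optE (pairE (pairE natE (rawE intE)) intE)) (fun w => w.2.2) := (snd _ _).snd'
  have hgT : CodeFP (pairE eσ (pairE natE (optE (pairE (pairE natE (rawE intE)) intE)))) (pairE natE (rawE intE))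
      (fun w => F.gT (I w.1) (v w.1) w.2.1) :=
    F.codeFP_gT (σ := σ × (ℕ × Option PLat)) (eσ := pairE eσ (pairE natE (optE (pairE (pairE natE (rawE intE)) intE))))
      (I := fun w => I w.1) (v := fun w => v w.1) (t := fun w => w.2.1) hroots hprime (hd.comp e1) (hord.comp e1) (hm.comp e1)
      (hps.comp e1) (hℓe.comp e1) (hℓy.comp e1) (hℓκ.comp e1) (hℓb.comp e1) (hv.comp e1) ht
  have hg : CodeFP (pairE eσ (pairE natE (optE (pairE (pairE natE (rawE intE)) intE)))) (pairE (pairE natE (rawE intE)) intE)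
      (fun w => F.redc (I w.1) (cap w.1) (F.gT (I w.1) (v w.1) w.2.1)) :=
    F.codeFP_redc (σ := σ × (ℕ × Option PLat)) (eσ := pairE eσ (pairE natE (optE (pairE (pairE natE (rawE intE)) intE))))
      (I := fun w => I w.1) (cap := fun w => cap w.1) (c := fun w => F.gT (I w.1) (v w.1) w.2.1) hred (hd.comp e1) (hord.comp e1)
      (hcap.comp e1) hgT
  have hdig : CodeFP (pairE eσ (pairE natE (optE (pairE (pairE natE (rawE intE)) intE)))) natE (fun w => (I w.1).digit (v w.1) w.2.1) :=
    Inst.codeFP_digit (σ := σ × (ℕ × Option PLat)) (eσ := pairE eσ (pairE natE (optE (pairE (pairE natE (rawE intE)) intE))))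
      (I := fun w => I w.1) (v := fun w => v w.1) (t := fun w => w.2.1) (hps.comp e1) (hℓe.comp e1) (hv.comp e1) ht
  have hpw : CodeFP (pairE eσ (pairE natE (optE (pairE (pairE natE (rawE intE)) intE)))) (optE (pairE (pairE natE (rawE intE)) intE))
      (fun w => F.powCc (I w.1) (cap w.1) (F.redc (I w.1) (cap w.1) (F.gT (I w.1) (v w.1) w.2.1)) ((I w.1).digit (v w.1) w.2.1)) :=
    F.codeFP_powCc (σ := σ × (ℕ × Option PLat)) (eσ := pairE eσ (pairE natE (optE (pairE (pairE natE (rawE intE)) intE))))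
      (I := fun w => I w.1) (cap := fun w => cap w.1) (g := fun w => F.redc (I w.1) (cap w.1) (F.gT (I w.1) (v w.1) w.2.1))
      (n := fun w => (I w.1).digit (v w.1) w.2.1) hlat hred hlat6 hred6 (hd.comp e1) (hord.comp e1) (hcap.comp e1) (hℓe.comp e1) hg
      (fun w => ⟨_, hred6 _, rfl⟩) hdig
  -- combining the power with the accumulator: two case analyses on options
  have f1 : CodeFP (pairE (pairE eσ (pairE natE (optE (pairE (pairE natE (rawE intE)) intE)))) (pairE (pairE natE (rawE intE)) intE)) eσ
      (fun r => r.1.1) := (fst _ _).fst'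
  have hmul : CodeFP (pairE (pairE (pairE eσ (pairE natE (optE (pairE (pairE natE (rawE intE)) intE)))) (pairE (pairE natE (rawE intE)) intE))
      (pairE (pairE natE (rawE intE)) intE)) (pairE (pairE natE (rawE intE)) intE) (fun r => F.starCc (I r.1.1.1) (cap r.1.1.1) r.2 r.1.2) :=
    F.codeFP_starCc (σ := ((σ × (ℕ × Option PLat)) × PLat) × PLat)
      (eσ := pairE (pairE (pairE eσ (pairE natE (optE (pairE (pairE natE (rawE intE)) intE)))) (pairE (pairE natE (rawE intE)) intE)) (pairE (pairE natE (rawE intE)) intE))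
      (I := fun r => I r.1.1.1) (cap := fun r => cap r.1.1.1) (p := fun r => r.2) (q := fun r => r.1.2) hlat hred
      (hd.comp (f1.comp (fst _ _))) (hord.comp (f1.comp (fst _ _))) (hcap.comp (f1.comp (fst _ _))) (snd _ _) (fst _ _).snd'
  have hin := optCases (σ := (σ × (ℕ × Option PLat)) × PLat)
    (eσ := pairE (pairE eσ (pairE natE (optE (pairE (pairE natE (rawE intE)) intE)))) (pairE (pairE natE (rawE intE)) intE))
    (eα := pairE (pairE natE (rawE intE)) intE) (eδ := optE (pairE (pairE natE (rawE intE)) intE))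
    (k := fun q o => o.elim (some q.2) fun y => some (F.starCc (I q.1.1) (cap q.1.1) y q.2))
    (gnone := fun q => some q.2) (gsome := fun r => some (F.starCc (I r.1.1.1) (cap r.1.1.1) r.2 r.1.2))
    ((optSome _).comp (snd _ _)) ((optSome _).comp hmul) (fun _ => rfl) (fun _ _ => rfl)
  have hin' : CodeFP (pairE (pairE eσ (pairE natE (optE (pairE (pairE natE (rawE intE)) intE)))) (pairE (pairE natE (rawE intE)) intE))
      (optE (pairE (pairE natE (rawE intE)) intE))
      (fun q => q.1.2.2.elim (some q.2) fun y => some (F.starCc (I q.1.1) (cap q.1.1) y q.2)) :=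
    (hin.comp ((CodeFP.id _).pair (fst _ _).snd'.snd') :)
  have hout := optCases (σ := σ × (ℕ × Option PLat))
    (eσ := pairE eσ (pairE natE (optE (pairE (pairE natE (rawE intE)) intE)))) (eα := pairE (pairE natE (rawE intE)) intE)
    (eδ := optE (pairE (pairE natE (rawE intE)) intE))
    (k := fun w o => o.elim w.2.2 fun x => w.2.2.elim (some x) fun y => some (F.starCc (I w.1) (cap w.1) y x))
    (gnone := fun w => w.2.2)
    (gsome := fun q => q.1.2.2.elim (some q.2) fun y => some (F.starCc (I q.1.1) (cap q.1.1) y q.2))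
    hacc hin' (fun _ => rfl) (fun _ _ => rfl)
  have hstep : CodeFP (pairE eσ (pairE natE (optE (pairE (pairE natE (rawE intE)) intE)))) (optE (pairE (pairE natE (rawE intE)) intE))
      (fun w => (F.powCc (I w.1) (cap w.1) (F.redc (I w.1) (cap w.1) (F.gT (I w.1) (v w.1) w.2.1)) ((I w.1).digit (v w.1) w.2.1)).elim
        w.2.2 fun x => w.2.2.elim (some x) fun y => some (F.starCc (I w.1) (cap w.1) y x)) :=
    (hout.comp ((CodeFP.id _).pair hpw) :)
  -- the size of `H = 2^ℓe (2^K' + 2^(K+1)) + 2^K`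
  have hH : ∀ s, (2 ^ (I s).ℓe * (2 ^ K'.eval (eσ s).length + 2 ^ (K.eval (eσ s).length + 1)) + 2 ^ K.eval (eσ s).length).size ≤
      Pl.eval (eσ s).length + K'.eval (eσ s).length + 2 * K.eval (eσ s).length + 4 := by
    intro s
    have hl : (I s).ℓe ≤ Pl.eval (eσ s).length := by have := hPl s; rwa [length_unE] at this
    have h1 := two_pow_add_two_pow_le (K'.eval (eσ s).length) (K.eval (eσ s).length + 1)
    have h2 : 2 ^ (I s).ℓe * (2 ^ K'.eval (eσ s).length + 2 ^ (K.eval (eσ s).length + 1)) ≤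
        2 ^ (Pl.eval (eσ s).length + (K'.eval (eσ s).length + (K.eval (eσ s).length + 1) + 1)) := by
      rw [pow_add 2 (Pl.eval (eσ s).length)]
      exact Nat.mul_le_mul (Nat.pow_le_pow_right Nat.two_pos hl) h1
    have h3 := (Nat.add_le_add_right h2 (2 ^ K.eval (eσ s).length)).trans (two_pow_add_two_pow_le _ _)
    refine Nat.size_le.2 (lt_of_le_of_lt h3 (Nat.pow_lt_pow_right Nat.one_lt_two (by omega)))
  have h := foldlInv (eσ := eσ) (eα := natE) (eβ := optE (pairE (pairE natE (rawE intE)) intE))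
    (step := fun s t acc => (F.powCc (I s) (cap s) (F.redc (I s) (cap s) (F.gT (I s) (v s) t)) ((I s).digit (v s) t)).elim acc
      fun x => acc.elim (some x) fun y => some (F.starCc (I s) (cap s) y x))
    (init := fun _ => none) (l := fun s => List.range (I s).T)
    (fun s j o => ∀ x, o = some x → (∃ y : Lat, y.2.length ≤ 6 ∧ x.1 = clampL (cap s) (I s).ord y) ∧
      x.2.natAbs + (2 ^ (I s).ℓe * (2 ^ K'.eval (eσ s).length + 2 ^ (K.eval (eσ s).length + 1)) + 2 ^ K.eval (eσ s).length) ≤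
        2 ^ j * (2 ^ (I s).ℓe * (2 ^ K'.eval (eσ s).length + 2 ^ (K.eval (eσ s).length + 1)) + 2 ^ K.eval (eσ s).length))
    hstep (const eσ none) (urange.comp (Inst.codeFP_T hps)) (fun _ x hx => by cases hx)
    (fun s j t o ho => fun x hx =>
      ⟨F.bEcStep_label hred6 (I s) (cap s) (v s) t o (fun x hx => (ho x hx).1) x hx,
        F.bEcStep_pos hlat6 (I s) (cap s) _ (hK s).2 (v s) _ (fun t => (hK' s t).le) t j o (fun x hx => (ho x hx).2) x hx⟩)
    (12 * K + 4 * K' + 4 * Pl + 4 * X + 26)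
    (fun s j o ho => by
      cases o with
      | none => exact Nat.zero_le _
      | some x =>
        obtain ⟨hx1, hx2⟩ := ho x rfl
        rw [length_optE_some]
        have hlen := length_PLatE_le (hK s).1 hx1 (le_trans (Nat.le_add_right _ _) hx2)
        have hHs := hH s
        have hm1 : K.eval (eσ s).length ≤ K.eval ((eσ s).length + j) := TM2Iter.eval_mono K (by omega)
        have hm2 : K'.eval (eσ s).length ≤ K'.eval ((eσ s).length + j) := TM2Iter.eval_mono K' (by omega)
        have hm3 : Pl.eval (eσ s).length ≤ Pl.eval ((eσ s).length + j) := TM2Iter.eval_mono Pl (by omega)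
        simp only [eval_add, eval_mul, eval_ofNat, eval_X]
        omega)
  have hget := (optGetD (pairE (pairE natE (rawE intE)) intE)).comp (h.pair (hord.pair (const eσ (0 : ℤ))))
  exact hget.congr fun s => (F.bEc_eq_foldl (I s) (cap s) (v s)).symm

/-- **The clamped shift `Δ` is computed on codes.** [folklore] -/
theorem codeFP_Δc {σ : Type} {eσ : σ → List Bool} {I : σ → Inst} {cap v : σ → ℕ}
    (hbEc : CodeFP eσ (pairE (pairE natE (rawE intE)) intE) (fun s => F.bEc (I s) (cap s) (v s)))
    (hps : CodeFP eσ (rawE natE) (fun s => (I s).ps)) (hℓe : CodeFP eσ unE (fun s => (I s).ℓe))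
    (hℓy : CodeFP eσ unE (fun s => (I s).ℓy)) (hr : CodeFP eσ natE (fun s => (I s).r))
    (hk : CodeFP eσ unE (fun s => (I s).k)) (hprec : CodeFP eσ unE (fun s => (I s).prec))
    (hs : CodeFP eσ unE (fun s => (I s).s)) (hv : CodeFP eσ natE v) :
    CodeFP eσ intE (fun s => F.Δc (I s) (cap s) (v s)) := by
  have htgt : CodeFP eσ intE (fun s => (((I s).tgt (v s) : ℕ) : ℤ)) := (intOfNat.comp (Inst.codeFP_tgt hps hℓe hℓy hr hk hprec hs hv) :)
  have hR : CodeFP eσ intE (fun s => (((I s).Rint : ℕ) : ℤ)) := (intOfNat.comp (Inst.codeFP_Rint hr hk hprec) :)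
  have hmod : CodeFP eσ intE (fun s => ((((I s).tgt (v s) : ℕ) : ℤ) - (F.bEc (I s) (cap s) (v s)).2) % (((I s).Rint : ℕ) : ℤ)) :=
    intEModOf ((intSub.comp (htgt.pair hbEc.snd')) :) hR
  exact ((intAdd.comp (hmod.pair hR)).congr fun s => rfl :)

/-- **The clamped absolute target `t⋆` is computed on codes.** [folklore] -/
theorem codeFP_tstarc {σ : Type} {eσ : σ → List Bool} {I : σ → Inst} {cap v : σ → ℕ}
    (hbEc : CodeFP eσ (pairE (pairE natE (rawE intE)) intE) (fun s => F.bEc (I s) (cap s) (v s)))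
    (hΔ : CodeFP eσ intE (fun s => F.Δc (I s) (cap s) (v s))) :
    CodeFP eσ intE (fun s => F.tstarc (I s) (cap s) (v s)) :=
  ((intAdd.comp (hbEc.snd'.pair hΔ)).congr fun _ => rfl :)

/-! ### The ladder base and the ladder -/

/-- **The per-product defect bound `KInt = 2^prec (10 size(ab) + 48)` is computed on codes.** [folklore] -/
theorem codeFP_KInt {σ : Type} {eσ : σ → List Bool} {I : σ → Inst}
    (ha : CodeFP eσ natE (fun s => (I s).a)) (hb : CodeFP eσ natE (fun s => (I s).b)) (hprec : CodeFP eσ unE (fun s => (I s).prec)) :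
    CodeFP eσ intE (fun s => (I s).KInt) := by
  have hsz : CodeFP eσ unE (fun s => (natE ((I s).a * (I s).b)).length) := (strLength.comp (strOfNat.comp (natMul.comp (ha.pair hb))) :)
  have hsz' : CodeFP eσ natE (fun s => Nat.size ((I s).a * (I s).b)) := (natOfUn.comp hsz).congr fun s => by simp [length_natE]
  have h : CodeFP eσ natE (fun s => 2 ^ (I s).prec * (10 * Nat.size ((I s).a * (I s).b) + 48)) :=
    (natMul.comp ((natPow.comp ((const eσ (2 : ℕ)).pair hprec)).pair (natAdd.comp ((natMul.comp ((const eσ (10 : ℕ)).pair hsz')).pair (const eσ (48 : ℕ))))) :)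
  exact ((intOfNat.comp h).congr fun s => rfl :)

/-- **One unguarded clamped baby step is computed on codes** (pointwise form). [cite: AroraBarak2009, §1.3] -/
theorem codeFP_stepc {σ : Type} {eσ : σ → List Bool} {I : σ → Inst} {cap : σ → ℕ} {st : σ → PLat}
    (hred : CodeFP (pairE (pairE (pairE natE natE) unE) (pairE natE (rawE intE))) (pairE (pairE natE (rawE intE)) intE) F.redL)
    (hd : CodeFP eσ (pairE (pairE natE natE) unE) (fun s => (I s).d)) (hord : CodeFP eσ (pairE natE (rawE intE)) (fun s => (I s).ord))
    (hcap : CodeFP eσ natE cap) (hst : CodeFP eσ (pairE (pairE natE (rawE intE)) intE) st) :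
    CodeFP eσ (pairE (pairE natE (rawE intE)) intE) (fun s => F.stepc (I s) (cap s) (st s)) := by
  have hrc := F.codeFP_redc hred hd hord hcap hst.fst'
  exact ((hrc.fst'.pair (intAdd.comp (hst.snd'.pair hrc.snd'))).congr fun s => rfl :)

/-- The label of an unguarded baby step is a clamp of a six-entry code. [folklore] -/
theorem stepc_label (hred6 : ∀ x, ((F.redL x).1).2.length ≤ 6) (I : Inst) (cap : ℕ) (st : PLat) :
    ∃ y : Lat, y.2.length ≤ 6 ∧ (F.stepc I cap st).1 = clampL cap I.ord y := ⟨_, hred6 _, rfl⟩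

/-- The position of an unguarded baby step from a clamped label grows by `< 2^K`. [folklore] -/
theorem stepc_pos (I : Inst) (cap K : ℕ)
    (hR : ∀ y : Lat, y.2.length ≤ 6 → ((F.redL (I.d, clampL cap I.ord y)).2).natAbs < 2 ^ K) (st : PLat)
    (hst : ∃ y : Lat, y.2.length ≤ 6 ∧ st.1 = clampL cap I.ord y) :
    ((F.stepc I cap st).2).natAbs ≤ (st.2).natAbs + 2 ^ K := by
  obtain ⟨y, hy, hst⟩ := hst
  have h := hR y hy
  rw [← hst] at h
  exact (Int.natAbs_add_le _ _).trans (by unfold redc red; dsimp only; omega)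

/-- **The ladder base: label and position** after `j` unguarded steps from `(ord, 0)`: a clamped label at position
`≤ j 2^K`. [cite: BuchmannWilliams1988, §3] -/
theorem iterate_stepc_inv (hred6 : ∀ x, ((F.redL x).1).2.length ≤ 6) (I : Inst) (cap K : ℕ)
    (hR : ∀ y : Lat, y.2.length ≤ 6 → ((F.redL (I.d, clampL cap I.ord y)).2).natAbs < 2 ^ K) (j : ℕ) :
    (∃ y : Lat, y.2.length ≤ 6 ∧ ((F.stepc I cap)^[j] (I.ord, 0)).1 = clampL cap I.ord y) ∧
      (((F.stepc I cap)^[j] (I.ord, 0)).2).natAbs ≤ j * 2 ^ K := by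
  induction j with
  | zero => exact ⟨⟨(cap + 1, []), Nat.zero_le _, (clampL_capSucc cap I.ord).symm⟩, Nat.zero_le _⟩
  | succ j ih =>
    rw [Function.iterate_succ_apply']
    refine ⟨F.stepc_label hred6 I cap _, (F.stepc_pos I cap K hR _ ih.1).trans ?_⟩
    have := ih.2
    generalize 2 ^ K = C at *
    rw [Nat.succ_mul]; omega

/-- **The ladder base `h` is computed on codes** (`s₀` unguarded clamped baby steps, `s₀` unary).
[cite: AroraBarak2009, §1.3; BuchmannWilliams1988, §3] -/
theorem codeFP_hbase {σ : Type} {eσ : σ → List Bool} {I : σ → Inst} {cap : σ → ℕ}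
    (hred : CodeFP (pairE (pairE (pairE natE natE) unE) (pairE natE (rawE intE))) (pairE (pairE natE (rawE intE)) intE) F.redL)
    (hred6 : ∀ x, ((F.redL x).1).2.length ≤ 6)
    (hd : CodeFP eσ (pairE (pairE natE natE) unE) (fun s => (I s).d)) (hord : CodeFP eσ (pairE natE (rawE intE)) (fun s => (I s).ord))
    (hcap : CodeFP eσ natE cap) (hs₀ : CodeFP eσ unE (fun s => (I s).s₀)) :
    CodeFP eσ (pairE (pairE natE (rawE intE)) intE) (fun s => F.hbase (I s) (cap s)) := by
  obtain ⟨K, hK⟩ := F.exists_logBound hred hd hord hcap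
  have hF : CodeFP (pairE eσ (pairE (pairE natE (rawE intE)) intE)) (pairE (pairE natE (rawE intE)) intE) (fun t => F.stepc (I t.1) (cap t.1) t.2) :=
    F.codeFP_stepc (σ := σ × PLat) (eσ := pairE eσ (pairE (pairE natE (rawE intE)) intE)) (I := fun t => I t.1)
      (cap := fun t => cap t.1) (st := fun t => t.2) hred (hd.comp (fst _ _)) (hord.comp (fst _ _)) (hcap.comp (fst _ _)) (snd _ _)
  have h := iterateInv (eσ := eσ) (eβ := pairE (pairE natE (rawE intE)) intE) (F := fun s st => F.stepc (I s) (cap s) st)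
    (init := fun s => ((I s).ord, (0 : ℤ))) (k := fun s => (I s).s₀)
    (fun s j st => (∃ y : Lat, y.2.length ≤ 6 ∧ st.1 = clampL (cap s) (I s).ord y) ∧ (st.2).natAbs ≤ j * 2 ^ K.eval (eσ s).length)
    hF (hord.pair (const eσ (0 : ℤ))) hs₀
    (fun s => ⟨⟨(cap s + 1, []), Nat.zero_le _, (clampL_capSucc (cap s) (I s).ord).symm⟩, Nat.zero_le _⟩)
    (fun s j st hst => ⟨F.stepc_label hred6 (I s) (cap s) st, (F.stepc_pos (I s) (cap s) _ (hK s).2 st hst.1).trans (by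
      have := hst.2
      generalize 2 ^ K.eval (eσ s).length = C at *
      rw [Nat.succ_mul]; omega)⟩)
    (4 * K + 2 * X + 4)
    (fun s j st hst => by
      have hx2 : (st.2).natAbs ≤ 2 ^ 0 * (j * 2 ^ K.eval (eσ s).length) := by rw [pow_zero, one_mul]; exact hst.2
      have hlen := length_PLatE_le (hK s).1 hst.1 hx2
      have hsz : (j * 2 ^ K.eval (eσ s).length).size ≤ j + K.eval (eσ s).length :=
        (IntWalkOps.size_mul_two_pow_le j _).trans (Nat.add_le_add_right (Nat.size_le.2 j.lt_two_pow_self) _)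
      have hm1 : K.eval (eσ s).length ≤ K.eval ((eσ s).length + j) := TM2Iter.eval_mono K (by omega)
      simp only [eval_add, eval_mul, eval_ofNat, eval_X]
      omega)
  exact h.congr fun s => rfl

/-- **The ladder: label and position** of `g_i`: a clamped label with `|pos g_i| + 2^K ≤ 2^i (s₀ + 1) 2^K`.
[cite: BuchmannWilliams1988, §3] -/
theorem ladder_inv (hlat6 : ∀ x, (F.latProd x).2.length ≤ 6) (hred6 : ∀ x, ((F.redL x).1).2.length ≤ 6) (I : Inst) (cap K : ℕ)
    (hR : ∀ y : Lat, y.2.length ≤ 6 → ((F.redL (I.d, clampL cap I.ord y)).2).natAbs < 2 ^ K) (i : ℕ) :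
    (∃ y : Lat, y.2.length ≤ 6 ∧ (F.ladder I cap i).1 = clampL cap I.ord y) ∧
      ((F.ladder I cap i).2).natAbs + 2 ^ K ≤ 2 ^ i * ((I.s₀ + 1) * 2 ^ K) := by
  induction i with
  | zero =>
    have h := F.iterate_stepc_inv hred6 I cap K hR I.s₀
    refine ⟨h.1, ?_⟩
    have := h.2
    unfold ladder hbase
    rw [Function.iterate_zero_apply, pow_zero, one_mul, Nat.succ_mul]
    generalize 2 ^ K = C at *
    omega
  | succ i ih =>
    unfold ladder at ih ⊢
    rw [Function.iterate_succ_apply']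
    refine ⟨F.exists_starCc_fst hred6 I cap _ _, ?_⟩
    have h1 := F.natAbs_starCc_snd_le hlat6 I cap K hR ((fun x => F.starCc I cap x x)^[i] (F.hbase I cap)) ((fun x => F.starCc I cap x x)^[i] (F.hbase I cap))
    have h2 := ih.2
    rw [pow_succ, mul_comm (2 ^ i) 2, mul_assoc]
    generalize 2 ^ i * ((I.s₀ + 1) * 2 ^ K) = A at *
    generalize 2 ^ K = C at *
    omega

/-- **The ladder `g_i` is computed on codes** (`i` clamped squarings of the base, `i` unary from the context).
[cite: AroraBarak2009, §1.3; BuchmannWilliams1988, §3] -/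
theorem codeFP_ladder {σ : Type} {eσ : σ → List Bool} {I : σ → Inst} {cap i : σ → ℕ}
    (hlat : CodeFP (pairE (pairE natE natE) (pairE (pairE natE (rawE intE)) (pairE natE (rawE intE)))) (pairE natE (rawE intE)) F.latProd) (hred : CodeFP (pairE (pairE (pairE natE natE) unE) (pairE natE (rawE intE))) (pairE (pairE natE (rawE intE)) intE) F.redL)
    (hlat6 : ∀ x, (F.latProd x).2.length ≤ 6) (hred6 : ∀ x, ((F.redL x).1).2.length ≤ 6)
    (hd : CodeFP eσ (pairE (pairE natE natE) unE) (fun s => (I s).d)) (hord : CodeFP eσ (pairE natE (rawE intE)) (fun s => (I s).ord))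
    (hcap : CodeFP eσ natE cap) (hs₀ : CodeFP eσ unE (fun s => (I s).s₀)) (hi : CodeFP eσ unE i) :
    CodeFP eσ (pairE (pairE natE (rawE intE)) intE) (fun s => F.ladder (I s) (cap s) (i s)) := by
  obtain ⟨K, hK⟩ := F.exists_logBound hred hd hord hcap
  obtain ⟨Ps, hPs⟩ := exists_length_le_eval hs₀
  have hF : CodeFP (pairE eσ (pairE (pairE natE (rawE intE)) intE)) (pairE (pairE natE (rawE intE)) intE) (fun t => F.starCc (I t.1) (cap t.1) t.2 t.2) :=
    F.codeFP_starCc (σ := σ × PLat) (eσ := pairE eσ (pairE (pairE natE (rawE intE)) intE)) (I := fun t => I t.1)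
      (cap := fun t => cap t.1) (p := fun t => t.2) (q := fun t => t.2) hlat hred (hd.comp (fst _ _)) (hord.comp (fst _ _))
      (hcap.comp (fst _ _)) (snd _ _) (snd _ _)
  have h := iterateInv (eσ := eσ) (eβ := pairE (pairE natE (rawE intE)) intE) (F := fun s x => F.starCc (I s) (cap s) x x)
    (init := fun s => F.hbase (I s) (cap s)) (k := i)
    (fun s j x => (∃ y : Lat, y.2.length ≤ 6 ∧ x.1 = clampL (cap s) (I s).ord y) ∧
      (x.2).natAbs + 2 ^ K.eval (eσ s).length ≤ 2 ^ j * (((I s).s₀ + 1) * 2 ^ K.eval (eσ s).length))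
    hF (F.codeFP_hbase hred hred6 hd hord hcap hs₀) hi
    (fun s => by have := F.ladder_inv hlat6 hred6 (I s) (cap s) _ (hK s).2 0; rwa [pow_zero, one_mul] at this ⊢)
    (fun s j x hx => by
      refine ⟨F.exists_starCc_fst hred6 (I s) (cap s) _ _, ?_⟩
      have h1 := F.natAbs_starCc_snd_le hlat6 (I s) (cap s) _ (hK s).2 x x
      have h2 := hx.2
      rw [pow_succ, mul_comm (2 ^ j) 2, mul_assoc]
      generalize 2 ^ j * (((I s).s₀ + 1) * 2 ^ K.eval (eσ s).length) = A at *
      generalize 2 ^ K.eval (eσ s).length = C at *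
      omega)
    (4 * K + 2 * Ps + 2 * X + 6)
    (fun s j x hx => by
      have hlen := length_PLatE_le (hK s).1 hx.1 (le_trans (Nat.le_add_right _ _) hx.2)
      have hs0 : (I s).s₀ ≤ Ps.eval (eσ s).length := by have := hPs s; rwa [length_unE] at this
      have hsz : (((I s).s₀ + 1) * 2 ^ K.eval (eσ s).length).size ≤ (I s).s₀ + 1 + K.eval (eσ s).length :=
        (IntWalkOps.size_mul_two_pow_le _ _).trans (Nat.add_le_add_right (Nat.size_le.2 (Nat.lt_two_pow_self)) _)
      have hm1 : K.eval (eσ s).length ≤ K.eval ((eσ s).length + j) := TM2Iter.eval_mono K (by omega)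
      have hm2 : Ps.eval (eσ s).length ≤ Ps.eval ((eσ s).length + j) := TM2Iter.eval_mono Ps (by omega)
      simp only [eval_add, eval_mul, eval_ofNat, eval_X]
      omega)
  exact h.congr fun s => rfl

end WalkFns

end CubicClassTable

end Literature.Computability.Cryptography
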